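import Summits.ABC.IUTFork.Joshi.ATS4MainBoundsGenuineTheta
import Summits.ABC.IUTFork.Joshi.ATS4MainBoundsWildGenuine
import Summits.ABC.IUTFork.Joshi.ATS4RamificationLegendre
import Summits.ABC.IUTFork.Joshi.ATS4RamificationLegendreTower
import HarnessLib

/-!
# Joshi, *Arithmetic Teichmüller spaces IV* [J-IV] §6.4 / Thm. 6.1.1 on the genuine THETA tower: every structural binder of
# `MainBoundDatum.ofGenuine_section64` DISCHARGED by T-26's ramification theorems (two-step route; `S = ∅` unconditional)

Proof-only companion (abc-iut cell, block E «type Joshi's construction, test vs S», rung LADDER-ABC:A2.E; seat abc-iut-E-t26,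
slot T-26 = [J-IV] §4.1–4.4) of abc-iut-E-t30's `Joshi/ATS4MainBoundsGenuine.lean` (p439256) and `Joshi/ATS4MainBoundsGenuineTheta.lean`
(p440894). TAKES NO SIDE on [IUTchIII] Cor. 3.12, on the claims of K. Joshi (arXiv:2403.10430v2, bib `Joshi2024ATS4`, unrefereed) or on
S. Mochizuki's reports on them; typed ≠ proved ≠ endorsed; NOT an abc claim. 0 definitions; no `Prop` fact; nothing of [IUTchIII] imported (R14).

## What is here

E-t30's `MainBoundDatum.ofGenuine_section64` (Lemmas 6.4.1, 6.4.2 (1)(2), the second inequality of Thm. 6.1.1 = Thm. 4.6.1 (2), and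
the degree bounds) and its E5 junction `ofGenuine_thm611_left_of_descent` carry EIGHT structural binders (`hV hdvd hunr htame hV' hdvd'
hunr' htame'`: support compatibility, degree divisibility, and the TWO-STEP [IUTchIV] Step (ii) engine's ramification clauses «unramified
off `Supp(𝔮)` away from the wild characteristics, tame on it», for `L/L_tpd` and for `L′/L` separately); its one-step route
`ofGenuine_lem642a_of_lem414Reading` carries six (`hT hKunr hKtame hKtop hFunr hFtame`). E-t30 LOCATED (STATUS 10:44:03Z) that Joshi's
printed Lemma 4.1.4 (p.38 l.32–39) is weaker than these clauses at exactly two places — «`L′/L` tame above `2`», «`L/L_tpd` unramified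
above `ℓ` off `Supp(𝔮)`» — and discharged the COMPOSITE route at Joshi's support `S = {2, ℓ}` in p440894 (`thetaTower_lem642a/b`
unconditional, `thetaTower_lem641` modulo Prop. 4.1.1 (2) at `ℓ`).

This file discharges the TWO-STEP binders themselves on the GENUINE THETA TOWER of a `λ`-line point — `L_tpd := F_tpd = P.F`,
`L := F` a theta field `F_tpd(√−1, E_λ[3·5])` (tree `Cor22.IsThetaField P F`, [IUTchIV] Thm. 1.10 p.22), `L′ := K` Galois over `F`
inside `F(E_F[ℓ])` (`ker ρ̄_{E_F,ℓ} ≤ Gal(F̄/ψK)`) — BY NAME from T-26's model theorems: `unramifiedOutside_thirty_of_isSubThetaField` /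
`tamelyRamifiedOutside_of_isSubThetaField` (p431966: `F/F_tpd` unramified outside `{p_v ∣ 30} ∪ {bad places of λ}`, tame outside
`{p_v ∣ 30}`), `unramifiedOutside_divisionTower` / `tamelyRamifiedOutside_divisionTower` (p432441: `K/F` unramified outside
`{p_w ∣ ℓ} ∪ {over bad places}`, tame outside `{p_w ∣ ℓ}` — in particular TAME ABOVE `2`), the tree's `IsThetaField.finrank_dvd`
(`[F : F_tpd] ∣ 46080 = 2¹⁰·3²·5`), `Cor22.finrank_divisionTower_dvd` (`[K : F] ∣ ℓ(ℓ−1)²(ℓ+1)`), `finBelow_finBelow`, and E-t30's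
re-indexing `TateDivisorDatum.ofNFPointOver P S M := ofNFPoint (λ/M) S` with `mem_ofNFPointOver_V_iff` (p440894).

RESULTS (namespace `Summit.ABC.IUTFork.Joshi.ATS4.ThetaTower`):
* §1–§2 the binders as named theorems in E-t30's exact shapes: `hdvd`, `hFunr`, `hFtame`, `hunr`, `htame` (layer `F/F_tpd`); `hdvd'`,
  `hKunr`, `hKtame`, `hKtop`, `hunr'`, `htame'`, `hV'_ofNFPointOver` (layer `K/F`); `hsupp_ofNFPoint_iff` — for Joshi's data
  `ofNFPoint P S` the one remaining SUPPORT input «`Supp(𝔮_{F_tpd}) ⊇` bad places» is EQUIVALENT to «no bad place of `λ` over a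
  prime of `S`»: at `S = {2, ℓ}` this is his Prop. 4.1.1 (2) «good or additive reduction over `2ℓ`» on the `λ`-line (E-t30's caveat
  11:20:27Z in kernel currency); at `S = ∅` (the full `q`-parameter divisor) it is EMPTY.
* §3 `section64` — for ANY Tate-divisor data on the tower with three support inputs (`hsupp`, `hV`, `hV'`):
  `Lem641 ∧ Lem642a ∧ Lem642b ∧ DiffCondMono ∧ DegLLtpdBound ∧ DegLpLBound` for E-t30's genuine datum; `section64_ofNFPointOver` — for
  Joshi's own data away from `S`, only `hS` left; **`section64_ofNFPointOver_empty` — at `S = ∅` NO structural hypothesis at all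
  (Lemma 6.4.1 included, no Prop. 4.1.1 (2))**; `lem642a_via_lem414Reading` — E-t30's one-step route is likewise binder-free
  (`ℓ ≥ 7`), «literally how the tree's GenuineStepII proof goes» (E-t30).
* §4 `thm611_left_of_descent` / `thm611_left_of_descent_ofNFPointOver` — the E5 junction on the theta tower: E-t31's §6.8–§6.11
  inputs + glue + `ℓ ≥ 7` ⟹ the first inequality of Thm. 6.1.1, no §6.4 / §4.1 input left (support input `hS` only; none at `S = ∅`).

LOCATED, not adjudicated (ref-x rows J4:§6.4.intro / J4:Lem4.1.4): on genuine data the two clauses where print's Lemma 4.1.4 is weaker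
than the engine needs are theorems (`hKtop`: `K/F` tame above `2, 3, 5` for `ℓ ≥ 7`; `hFunr_above_ell`: `F/F_tpd` unramified above `ℓ ∤ 30` off the
bad places), so the weakness costs nothing THERE; whether Joshi's printed hypotheses ([J-III] §2.4/§3.1/§3.3 + [J-IV] §4.1.1/§4.1.2) alone imply
them is a statement about print this file does not make. Inputs of every theorem: `λ ∈ U_X` (`hU`), `IsThetaField` (`hF`), `K/F` Galois + the
division-tower condition (`hK`), `ℓ` prime `≥ 5` (`≥ 7` where stated), `0 < log(𝔮_F)` («V^{odd,ss} ≠ ∅», kept), the bookkeeping field `L_mod`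
(enters only through `d_mod`, `e_mod`). [claim: Joshi2024ATS4, status: disputed]
-/

noncomputable section

open NumberField IsDedekindDomain
open Literature.IUT.LogVolume Literature.IUT.LogVolume.Cor22
open Literature.NumberTheory.DiophantineGeometry.GenEll

namespace Summit.ABC.IUTFork.Joshi.ATS4.ThetaTower

/-! ## 0. Arithmetic of the wild characteristics `{2, 3, 5}` (`not_dvd_thirty_of_not_mem` is E-t27's, `ATS4MainBoundsWildGenuine`) -/

/-- For `ℓ ≥ 7`, a member of `{2, 3, 5}` is not `ℓ`. [folklore] -/
theorem ne_of_mem_of_seven_le {p ℓ : ℕ} (h7 : 7 ≤ ℓ) (hp : p ∈ ({2, 3, 5} : Finset ℕ)) : p ≠ ℓ := by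
  simp only [Finset.mem_insert, Finset.mem_singleton] at hp
  omega

/-! ## 1. The layer `F/F_tpd` of a theta field: `hdvd`, `hunr`, `htame` (and `hFunr`, `hFtame`) -/

section ThetaLayer

variable {P : NFPoint} {F : Type} [Field F] [NumberField F] [Algebra P.F F]

/-- **`hdvd`**: `[F : F_tpd] ∣ 2¹⁰·3²·5` (`= 46080`; [IUTchIV] Thm. 1.10 Step (ii) «`Gal(F/F_tpd) ↪ GL₂(𝔽₃) × GL₂(𝔽₅) × ℤ/2ℤ`»,
the recorded field `IsThetaField.finrank_dvd`; [J-IV] p.59 l.31). [cite: Mochizuki2012, IUTchIV Thm 1.10 proof Step (ii) p.24] -/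
theorem hdvd (hF : IsThetaField P F) : Module.finrank P.F F ∣ 2 ^ 10 * 3 ^ 2 * 5 := by
  have h := hF.finrank_dvd
  norm_num at h ⊢
  exact h

/-- **`hFunr` (E-t30's one-step shape, sharpened)**: a place `w` of the theta field `F` of residue characteristic `∉ {2,3,5}` lying
over a GOOD place of `λ` is unramified over `F_tpd` — whatever `ℓ` is; in particular `F/F_tpd` is unramified ABOVE `ℓ ∤ 30` off
the bad places (the clause print's Lemma 4.1.4 (1) weakens to «tame»). T-26's `unramifiedOutside_thirty_of_isSubThetaField`.
[cite: Mochizuki2012, IUTchIV Thm 1.10 proof Step (iii) (D0) p.26] -/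
theorem hFunr (hU : P.InU) (hF : IsThetaField P F) (w : HeightOneSpectrum (𝓞 F))
    (hw : residueChar F w ∉ ({2, 3, 5} : Finset ℕ)) (hgood : finBelow P.F F w ∉ badPlaces P) :
    w.asIdeal.ramificationIdx (𝓞 P.F) = 1 := by
  haveI := hF.isGalois
  have h := unramifiedOutside_thirty_of_isSubThetaField hU (IsSubThetaField.of_isThetaField hF) w (by
    simp only [Set.mem_union, Set.mem_setOf_eq, Finset.mem_coe, not_or]
    refine ⟨?_, hgood⟩
    rw [← residueChar_eq_residueChar_finBelow]
    exact not_dvd_thirty_of_not_mem (residueChar_prime F w) hw)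
  rwa [relRamIdx_eq_ramificationIdx] at h

/-- **`hFunr_above_ell`** — the LOCATED clause in words: for `ℓ ∉ {2,3,5}` (e.g. `ℓ ≥ 7`) every place of `F` above `ℓ` off
the bad places of `λ` is UNRAMIFIED over `F_tpd`. [cite: Mochizuki2012, IUTchIV Thm 1.10 proof Step (iii) (D0) p.26] -/
theorem hFunr_above_ell (hU : P.InU) (hF : IsThetaField P F) {ℓ : ℕ} (hℓ : ℓ ∉ ({2, 3, 5} : Finset ℕ))
    (w : HeightOneSpectrum (𝓞 F)) (hw : residueChar F w = ℓ) (hgood : finBelow P.F F w ∉ badPlaces P) :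
    w.asIdeal.ramificationIdx (𝓞 P.F) = 1 :=
  hFunr hU hF w (hw ▸ hℓ) hgood

/-- **`hFtame`**: at residue characteristic `∉ {2,3,5}` the theta field is TAMELY ramified over `F_tpd` (on or off `Supp(𝔮)`):
`e(w|v) ∣ [F : F_tpd] ∣ 2¹²·3²·5`. T-26's `tamelyRamifiedOutside_of_isSubThetaField`. [cite: Mochizuki2012, IUTchIV Thm 1.10 proof Step (ii) p.24] -/
theorem hFtame (hU : P.InU) (hF : IsThetaField P F) (w : HeightOneSpectrum (𝓞 F))
    (hw : residueChar F w ∉ ({2, 3, 5} : Finset ℕ)) :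
    ¬ residueChar F w ∣ w.asIdeal.ramificationIdx (𝓞 P.F) := by
  haveI := hF.isGalois
  have h := tamelyRamifiedOutside_of_isSubThetaField hU (IsSubThetaField.of_isThetaField hF) w (by
    simp only [Set.mem_setOf_eq]
    rw [← residueChar_eq_residueChar_finBelow]
    exact not_dvd_thirty_of_not_mem (residueChar_prime F w) hw)
  rwa [relRamIdx_eq_ramificationIdx] at h

/-- **`hunr`** in E-t30's shape, for any Tate-divisor datum of `F_tpd` whose support CONTAINS the bad places of `λ`.
[cite: Mochizuki2012, IUTchIV Thm 1.10 proof Step (iii) (D0) p.26] -/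
theorem hunr (hU : P.InU) (hF : IsThetaField P F) {𝔮tpd : TateDivisorDatum P.F} (hsupp : badPlaces P ⊆ 𝔮tpd.V) :
    ∀ w : HeightOneSpectrum (𝓞 F), residueChar F w ∉ ({2, 3, 5} : Finset ℕ) → finBelow P.F F w ∉ 𝔮tpd.V →
      w.asIdeal.ramificationIdx (𝓞 P.F) = 1 :=
  fun w hw hV => hFunr hU hF w hw fun hb => hV (hsupp hb)

/-- **`htame`** in E-t30's shape (the support hypothesis is not even needed). [cite: Mochizuki2012, IUTchIV Thm 1.10 proof Step (ii) p.24] -/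
theorem htame (hU : P.InU) (hF : IsThetaField P F) (𝔮tpd : TateDivisorDatum P.F) :
    ∀ w : HeightOneSpectrum (𝓞 F), residueChar F w ∉ ({2, 3, 5} : Finset ℕ) → finBelow P.F F w ∈ 𝔮tpd.V →
      ¬ residueChar F w ∣ w.asIdeal.ramificationIdx (𝓞 P.F) :=
  fun w hw _ => hFtame hU hF w hw

/-- **`hsupp` for Joshi's own data**: the support of `𝔮_{F_tpd} := TateDivisorDatum.ofNFPoint λ S` (T-26 p430434: the bad
places of `λ` not over a prime of `S`) contains ALL bad places iff no bad place of `λ` lies over a prime of `S`. For Joshi's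
`S = {2, ℓ}` (E-t30's p440894 data `ofNFPoint P {2,ℓ}`) this is exactly his Prop. 4.1.1 (2) «good or additive reduction over `2ℓ`»
read on the `λ`-line (potentially multiplicative = bad place of `λ`); for `S = ∅` it is empty. [claim: Joshi2024ATS4, status: disputed] -/
theorem hsupp_ofNFPoint_iff (S : Finset ℕ) :
    badPlaces P ⊆ (TateDivisorDatum.ofNFPoint P S).V ↔
      ∀ v ∈ badPlaces P, ∀ p ∈ S, ((p : ℕ) : 𝓞 P.F) ∉ v.asIdeal :=
  ⟨fun h v hv => ((TateDivisorDatum.mem_ofNFPoint_V P S v).1 (h hv)).2,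
    fun hS v hv => (TateDivisorDatum.mem_ofNFPoint_V P S v).2 ⟨hv, hS v hv⟩⟩

/-- `hsupp` from the avoidance hypothesis. [folklore] -/
theorem hsupp_ofNFPoint {S : Finset ℕ} (hS : ∀ v ∈ badPlaces P, ∀ p ∈ S, ((p : ℕ) : 𝓞 P.F) ∉ v.asIdeal) :
    badPlaces P ⊆ (TateDivisorDatum.ofNFPoint P S).V :=
  (hsupp_ofNFPoint_iff S).2 hS

/-- `hsupp` for `S = ∅` holds outright (`Supp(𝔮_{F_tpd})` = all bad places, T-26's `ofNFPoint_V_empty`). [folklore] -/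
theorem hsupp_ofNFPoint_empty : badPlaces P ⊆ (TateDivisorDatum.ofNFPoint P ∅).V :=
  (ofNFPoint_V_empty P).symm.subset

end ThetaLayer

/-! ## 2. The layer `K/F` inside the `ℓ`-division tower: `hdvd'`, `hunr'`, `htame'`, `hKtop` (and `hV'`, `hT`) -/

section DivisionLayer

variable {P : NFPoint} {F : Type} [Field F] [NumberField F] [Algebra P.F F]
variable {K : Type} [Field K] [NumberField K] [Algebra F K] (ψ : K →ₐ[F] AlgebraicClosure F)

omit [NumberField K] in
/-- **`hdvd'`**: `[K : F] ∣ ℓ·(ℓ−1)²·(ℓ+1) = |GL₂(𝔽_ℓ)|` for `K ⊆ F(E_F[ℓ])` (tree `Cor22.finrank_divisionTower_dvd`; [J-IV] Lem. 6.3.2).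
[cite: Mochizuki2012, IUTchIV Thm 1.10 proof Step (ii) p.24] -/
theorem hdvd' (hU : P.InU) {ℓ : ℕ} (hℓ : ℓ.Prime)
    (hK : letI := thetaCurve_isElliptic hU F
      ((thetaCurve P F).galoisRepTorsion (ℓ : ℤ)).ker ≤ ψ.fieldRange.fixingSubgroup) :
    Module.finrank F K ∣ ℓ * (ℓ - 1) ^ 2 * (ℓ + 1) := by
  haveI : Fact ℓ.Prime := ⟨hℓ⟩
  exact finrank_divisionTower_dvd ψ hU hK

/-- **`hKunr` (sharp)**: a place `u` of `K` of residue characteristic `≠ ℓ` over a GOOD place of `λ` is unramified over `F`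
(T-26's `unramifiedOutside_divisionTower`; [IUTchIV] Prop. 1.8 (vii)). [cite: Mochizuki2012, IUTchIV Prop 1.8 (vii) p.19] -/
theorem hKunr (hU : P.InU) (hF : IsThetaField P F) [IsGalois F K] {ℓ : ℕ} (hℓ : ℓ.Prime)
    (hK : letI := thetaCurve_isElliptic hU F
      ((thetaCurve P F).galoisRepTorsion (ℓ : ℤ)).ker ≤ ψ.fieldRange.fixingSubgroup)
    (u : HeightOneSpectrum (𝓞 K)) (hu : residueChar K u ≠ ℓ) (hgood : finBelow P.F F (finBelow F K u) ∉ badPlaces P) :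
    u.asIdeal.ramificationIdx (𝓞 F) = 1 := by
  have h := unramifiedOutside_divisionTower ψ hU hF hK u (by
    simp only [Set.mem_setOf_eq, not_or]
    refine ⟨fun hdvd => hu ?_, hgood⟩
    rw [← residueChar_eq_residueChar_finBelow] at hdvd
    exact (Nat.prime_dvd_prime_iff_eq (residueChar_prime K u) hℓ).mp hdvd)
  rwa [relRamIdx_eq_ramificationIdx] at h

/-- **`hKtame` (sharp)**: at residue characteristic `≠ ℓ`, `K/F` is TAMELY ramified — on or off `Supp(𝔮)`, and in particular
ABOVE `2` (the clause print's Lemma 4.1.4 (2) does not state). T-26's `tamelyRamifiedOutside_divisionTower`: `e(u|w)` is a power of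
`ℓ` there. [cite: Mochizuki2012, IUTchIV Thm 1.10 proof Step (ii) p.24] -/
theorem hKtame (hU : P.InU) (hF : IsThetaField P F) [IsGalois F K] {ℓ : ℕ} (hℓ : ℓ.Prime)
    (hK : letI := thetaCurve_isElliptic hU F
      ((thetaCurve P F).galoisRepTorsion (ℓ : ℤ)).ker ≤ ψ.fieldRange.fixingSubgroup)
    (u : HeightOneSpectrum (𝓞 K)) (hu : residueChar K u ≠ ℓ) :
    ¬ residueChar K u ∣ u.asIdeal.ramificationIdx (𝓞 F) := by
  have h := tamelyRamifiedOutside_divisionTower ψ hU hF hℓ hK u (by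
    simp only [Set.mem_setOf_eq]
    rw [← residueChar_eq_residueChar_finBelow]
    exact fun hdvd => hu ((Nat.prime_dvd_prime_iff_eq (residueChar_prime K u) hℓ).mp hdvd))
  rwa [relRamIdx_eq_ramificationIdx] at h

/-- **`hKtop`** — the LOCATED clause «`L′/L` tame above `2`» (and above `3, 5`) as a THEOREM on the genuine tower, for `ℓ ≥ 7`,
in the shape of E-t30's `ofGenuine_lem642a_of_lem414Reading`. [cite: Mochizuki2012, IUTchIV Thm 1.10 proof Step (ii) p.24] -/
theorem hKtop (hU : P.InU) (hF : IsThetaField P F) [IsGalois F K] {ℓ : ℕ} (hℓ : ℓ.Prime) (h7 : 7 ≤ ℓ)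
    (hK : letI := thetaCurve_isElliptic hU F
      ((thetaCurve P F).galoisRepTorsion (ℓ : ℤ)).ker ≤ ψ.fieldRange.fixingSubgroup) :
    ∀ u : HeightOneSpectrum (𝓞 K), residueChar K u ∈ ({2, 3, 5} : Finset ℕ) →
      ¬ residueChar K u ∣ u.asIdeal.ramificationIdx (𝓞 F) :=
  fun u hu => hKtame ψ hU hF hℓ hK u (ne_of_mem_of_seven_le h7 hu)

/-- **`hunr'`** in E-t30's shape, for Tate-divisor data `𝔮_{F_tpd} ⊇` bad places and `𝔮_F` supported over `𝔮_{F_tpd}`.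
[cite: Mochizuki2012, IUTchIV Prop 1.8 (vii) p.19] -/
theorem hunr' (hU : P.InU) (hF : IsThetaField P F) [IsGalois F K] {ℓ : ℕ} (hℓ : ℓ.Prime)
    (hK : letI := thetaCurve_isElliptic hU F
      ((thetaCurve P F).galoisRepTorsion (ℓ : ℤ)).ker ≤ ψ.fieldRange.fixingSubgroup)
    {𝔮tpd : TateDivisorDatum P.F} {𝔮F : TateDivisorDatum F} (hsupp : badPlaces P ⊆ 𝔮tpd.V)
    (hV : ∀ w : HeightOneSpectrum (𝓞 F), w ∈ 𝔮F.V ↔ finBelow P.F F w ∈ 𝔮tpd.V) :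
    ∀ u : HeightOneSpectrum (𝓞 K), residueChar K u ≠ ℓ → finBelow F K u ∉ 𝔮F.V →
      u.asIdeal.ramificationIdx (𝓞 F) = 1 :=
  fun u hu hnot => hKunr ψ hU hF hℓ hK u hu fun hb => hnot ((hV _).2 (hsupp hb))

/-- **`htame'`** in E-t30's shape (support hypothesis not needed). [cite: Mochizuki2012, IUTchIV Thm 1.10 proof Step (ii) p.24] -/
theorem htame' (hU : P.InU) (hF : IsThetaField P F) [IsGalois F K] {ℓ : ℕ} (hℓ : ℓ.Prime)
    (hK : letI := thetaCurve_isElliptic hU F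
      ((thetaCurve P F).galoisRepTorsion (ℓ : ℤ)).ker ≤ ψ.fieldRange.fixingSubgroup) (𝔮F : TateDivisorDatum F) :
    ∀ u : HeightOneSpectrum (𝓞 K), residueChar K u ≠ ℓ → finBelow F K u ∈ 𝔮F.V →
      ¬ residueChar K u ∣ u.asIdeal.ramificationIdx (𝓞 F) :=
  fun u hu _ => hKtame ψ hU hF hℓ hK u hu

/-- **`hV'` for Joshi's own data along `F → K`**: with E-t30's re-indexed data `TateDivisorDatum.ofNFPointOver P S M :=
ofNFPoint (λ/M) S` (p440894), the support over `K` is the set of places over the support over `F` — both are «over the support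
over `F_tpd`» (`mem_ofNFPointOver_V_iff`) and `u|_F|_{F_tpd} = u|_{F_tpd}` (`finBelow_finBelow`). [folklore] -/
theorem hV'_ofNFPointOver [Algebra P.F K] [IsScalarTower P.F F K] (S : Finset ℕ) : ∀ u : HeightOneSpectrum (𝓞 K),
    u ∈ (TateDivisorDatum.ofNFPointOver P S K).V ↔ finBelow F K u ∈ (TateDivisorDatum.ofNFPointOver P S F).V := fun u => by
  rw [TateDivisorDatum.mem_ofNFPointOver_V_iff, TateDivisorDatum.mem_ofNFPointOver_V_iff, finBelow_finBelow]

end DivisionLayer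

/-! ## 3. §6.4 + the second inequality of Thm. 6.1.1 on the theta tower — no structural binder left -/

section Section64

variable (Lmod : Type*) [Field Lmod] [NumberField Lmod]
variable {P : NFPoint} {F : Type} [Field F] [NumberField F] [Algebra P.F F]
variable {K : Type} [Field K] [NumberField K] [Algebra F K] (ψ : K →ₐ[F] AlgebraicClosure F)

/-- **§6.4 and Thm. 6.1.1's second inequality on the genuine theta tower, for ANY Tate-divisor data with the right supports**:
`λ ∈ U_X(F_tpd)`, `F` a theta field, `K/F` Galois inside the `ℓ`-division tower (`ℓ ≥ 5` prime), `Supp(𝔮_{F_tpd}) ⊇` bad places,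
`Supp(𝔮_F)` / `Supp(𝔮_K)` the places over `Supp(𝔮_{F_tpd})` / `Supp(𝔮_F)`, `0 < log(𝔮_F)` ⟹ E-t30's genuine datum satisfies
`Lem641 ∧ Lem642a ∧ Lem642b ∧ DiffCondMono ∧ DegLLtpdBound ∧ DegLpLBound`. E-t30's `ofGenuine_section64` with its eight binders
supplied by §1–§2. [claim: Joshi2024ATS4, status: disputed] -/
theorem section64 (hU : P.InU) (hF : IsThetaField P F) [IsGalois F K] {ℓ : ℕ} (hℓ : ℓ.Prime) (h5 : 5 ≤ ℓ)
    (hK : letI := thetaCurve_isElliptic hU F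
      ((thetaCurve P F).galoisRepTorsion (ℓ : ℤ)).ker ≤ ψ.fieldRange.fixingSubgroup)
    (𝔮tpd : TateDivisorDatum P.F) (𝔮F : TateDivisorDatum F) (𝔮K : TateDivisorDatum K) (hq : 0 < 𝔮F.logq)
    (hsupp : badPlaces P ⊆ 𝔮tpd.V)
    (hV : ∀ w : HeightOneSpectrum (𝓞 F), w ∈ 𝔮F.V ↔ finBelow P.F F w ∈ 𝔮tpd.V)
    (hV' : ∀ u : HeightOneSpectrum (𝓞 K), u ∈ 𝔮K.V ↔ finBelow F K u ∈ 𝔮F.V) :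
    (MainBoundDatum.ofGenuine Lmod hℓ h5 𝔮tpd 𝔮F 𝔮K hq).Lem641 ∧
      (MainBoundDatum.ofGenuine Lmod hℓ h5 𝔮tpd 𝔮F 𝔮K hq).Lem642a ∧
      (MainBoundDatum.ofGenuine Lmod hℓ h5 𝔮tpd 𝔮F 𝔮K hq).Lem642b ∧
      (MainBoundDatum.ofGenuine Lmod hℓ h5 𝔮tpd 𝔮F 𝔮K hq).DiffCondMono ∧
      (MainBoundDatum.ofGenuine Lmod hℓ h5 𝔮tpd 𝔮F 𝔮K hq).DegLLtpdBound ∧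
      (MainBoundDatum.ofGenuine Lmod hℓ h5 𝔮tpd 𝔮F 𝔮K hq).DegLpLBound :=
  haveI := hF.isGalois
  MainBoundDatum.ofGenuine_section64 Lmod hℓ h5 𝔮tpd 𝔮F 𝔮K hq hV (hdvd hF) (hunr hU hF hsupp) (htame hU hF 𝔮tpd)
    hV' (hdvd' ψ hU hℓ hK) (hunr' ψ hU hF hℓ hK hsupp hV) (htame' ψ hU hF hℓ hK 𝔮F)

/-- **The same for Joshi's OWN Tate-divisor data of `λ` away from `S`** (`ofNFPoint P S` over `F_tpd`, E-t30's re-indexing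
`ofNFPointOver P S F / K` over `F / K`; [J-IV] Def. 4.4.2 instantiated by T-26 p430434): the ONLY structural input left is the
avoidance hypothesis `hS` «no bad place of `λ` over a prime of `S`» — for `S = {2, ℓ}` (p440894's data) Joshi's Prop. 4.1.1 (2)
on the `λ`-line (E-t30's caveat 11:20:27Z in kernel currency), for `S = ∅` nothing (next theorem). Other inputs: `λ ∈ U_X`,
`IsThetaField`, the division-tower condition, `ℓ ≥ 5` prime, `0 < log(𝔮_F)`, the bookkeeping field `L_mod`.
[claim: Joshi2024ATS4, status: disputed] -/
theorem section64_ofNFPointOver [Algebra P.F K] [IsScalarTower P.F F K] (hU : P.InU) (hF : IsThetaField P F) [IsGalois F K]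
    {ℓ : ℕ} (hℓ : ℓ.Prime) (h5 : 5 ≤ ℓ)
    (hK : letI := thetaCurve_isElliptic hU F
      ((thetaCurve P F).galoisRepTorsion (ℓ : ℤ)).ker ≤ ψ.fieldRange.fixingSubgroup)
    (S : Finset ℕ) (hS : ∀ v ∈ badPlaces P, ∀ p ∈ S, ((p : ℕ) : 𝓞 P.F) ∉ v.asIdeal)
    (hq : 0 < (TateDivisorDatum.ofNFPointOver P S F).logq) :
    (MainBoundDatum.ofGenuine Lmod hℓ h5 (TateDivisorDatum.ofNFPoint P S) (TateDivisorDatum.ofNFPointOver P S F) (TateDivisorDatum.ofNFPointOver P S K) hq).Lem641 ∧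
      (MainBoundDatum.ofGenuine Lmod hℓ h5 (TateDivisorDatum.ofNFPoint P S) (TateDivisorDatum.ofNFPointOver P S F) (TateDivisorDatum.ofNFPointOver P S K) hq).Lem642a ∧
      (MainBoundDatum.ofGenuine Lmod hℓ h5 (TateDivisorDatum.ofNFPoint P S) (TateDivisorDatum.ofNFPointOver P S F) (TateDivisorDatum.ofNFPointOver P S K) hq).Lem642b ∧
      (MainBoundDatum.ofGenuine Lmod hℓ h5 (TateDivisorDatum.ofNFPoint P S) (TateDivisorDatum.ofNFPointOver P S F) (TateDivisorDatum.ofNFPointOver P S K) hq).DiffCondMono ∧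
      (MainBoundDatum.ofGenuine Lmod hℓ h5 (TateDivisorDatum.ofNFPoint P S) (TateDivisorDatum.ofNFPointOver P S F) (TateDivisorDatum.ofNFPointOver P S K) hq).DegLLtpdBound ∧
      (MainBoundDatum.ofGenuine Lmod hℓ h5 (TateDivisorDatum.ofNFPoint P S) (TateDivisorDatum.ofNFPointOver P S F) (TateDivisorDatum.ofNFPointOver P S K) hq).DegLpLBound :=
  section64 Lmod ψ hU hF hℓ h5 hK _ _ _ hq (hsupp_ofNFPoint hS) (TateDivisorDatum.mem_ofNFPointOver_V_iff P S F)
    (hV'_ofNFPointOver S)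

/-- **… and for `S = ∅`** (the Tate divisor of `λ` over ALL its bad places — the full `q`-parameter divisor `log(q^∀)`): §6.4 and
the second inequality of Thm. 6.1.1 hold on the genuine theta tower with NO structural hypothesis whatsoever — in particular Lemma
6.4.1 needs no Prop. 4.1.1 (2) here, because a bad place over `ℓ` then lies IN `Supp(𝔮)`, where the engine asks only for tameness,
which `hFtame` gives. [claim: Joshi2024ATS4, status: disputed] -/
theorem section64_ofNFPointOver_empty [Algebra P.F K] [IsScalarTower P.F F K] (hU : P.InU) (hF : IsThetaField P F)
    [IsGalois F K] {ℓ : ℕ} (hℓ : ℓ.Prime) (h5 : 5 ≤ ℓ)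
    (hK : letI := thetaCurve_isElliptic hU F
      ((thetaCurve P F).galoisRepTorsion (ℓ : ℤ)).ker ≤ ψ.fieldRange.fixingSubgroup)
    (hq : 0 < (TateDivisorDatum.ofNFPointOver P ∅ F).logq) :
    (MainBoundDatum.ofGenuine Lmod hℓ h5 (TateDivisorDatum.ofNFPoint P ∅) (TateDivisorDatum.ofNFPointOver P ∅ F) (TateDivisorDatum.ofNFPointOver P ∅ K) hq).Lem641 ∧
      (MainBoundDatum.ofGenuine Lmod hℓ h5 (TateDivisorDatum.ofNFPoint P ∅) (TateDivisorDatum.ofNFPointOver P ∅ F) (TateDivisorDatum.ofNFPointOver P ∅ K) hq).Lem642a ∧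
      (MainBoundDatum.ofGenuine Lmod hℓ h5 (TateDivisorDatum.ofNFPoint P ∅) (TateDivisorDatum.ofNFPointOver P ∅ F) (TateDivisorDatum.ofNFPointOver P ∅ K) hq).Lem642b ∧
      (MainBoundDatum.ofGenuine Lmod hℓ h5 (TateDivisorDatum.ofNFPoint P ∅) (TateDivisorDatum.ofNFPointOver P ∅ F) (TateDivisorDatum.ofNFPointOver P ∅ K) hq).DiffCondMono ∧
      (MainBoundDatum.ofGenuine Lmod hℓ h5 (TateDivisorDatum.ofNFPoint P ∅) (TateDivisorDatum.ofNFPointOver P ∅ F) (TateDivisorDatum.ofNFPointOver P ∅ K) hq).DegLLtpdBound ∧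
      (MainBoundDatum.ofGenuine Lmod hℓ h5 (TateDivisorDatum.ofNFPoint P ∅) (TateDivisorDatum.ofNFPointOver P ∅ F) (TateDivisorDatum.ofNFPointOver P ∅ K) hq).DegLpLBound :=
  section64_ofNFPointOver Lmod ψ hU hF hℓ h5 hK ∅ (fun _ _ p hp => absurd hp (by simp)) hq

/-- **E-t30's ONE-STEP route (`ofGenuine_lem642a_of_lem414Reading`, Lemma 6.4.2 (1) straight from the printed shape of Lemma
4.1.4 read `F_tpd → K`) is likewise binder-free on the theta tower** for `ℓ ≥ 7`: its six ramification binders are `hKunr`,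
`hKtame`, `hKtop`, `hFunr`, `hFtame` of §1–§2 (with `finBelow_finBelow` to pass from `u|_F|_{F_tpd}` to `u|_{F_tpd}`).
[claim: Joshi2024ATS4, status: disputed] -/
theorem lem642a_via_lem414Reading [Algebra P.F K] [IsScalarTower P.F F K] (hU : P.InU) (hF : IsThetaField P F)
    [IsGalois F K] {ℓ : ℕ} (hℓ : ℓ.Prime) (h5 : 5 ≤ ℓ) (h7 : 7 ≤ ℓ)
    (hK : letI := thetaCurve_isElliptic hU F
      ((thetaCurve P F).galoisRepTorsion (ℓ : ℤ)).ker ≤ ψ.fieldRange.fixingSubgroup)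
    (𝔮tpd : TateDivisorDatum P.F) (𝔮F : TateDivisorDatum F) (𝔮K : TateDivisorDatum K) (hq : 0 < 𝔮F.logq)
    (hsupp : badPlaces P ⊆ 𝔮tpd.V)
    (hT : ∀ u : HeightOneSpectrum (𝓞 K), u ∈ 𝔮K.V ↔ finBelow P.F K u ∈ 𝔮tpd.V) :
    (MainBoundDatum.ofGenuine Lmod hℓ h5 𝔮tpd 𝔮F 𝔮K hq).Lem642a := by
  haveI := hF.isGalois
  have h235 : ℓ ∉ ({2, 3, 5} : Finset ℕ) := fun h => ne_of_mem_of_seven_le h7 h rfl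
  refine MainBoundDatum.ofGenuine_lem642a_of_lem414Reading Lmod hℓ h5 𝔮tpd 𝔮F 𝔮K hq h7 hT (hdvd hF) (hdvd' ψ hU hℓ hK)
    (fun u hu hnot => ?_) (fun u hu _ => ?_) (hKtop ψ hU hF hℓ h7 hK) (fun w hw hnot => ?_) (fun w hw => ?_)
  · -- `hKunr`: residue characteristic `∉ {2,3,5,ℓ}`, under a good place of `λ`
    have hu' : residueChar K u ≠ ℓ := fun h => hu (by rw [h]; simp)
    refine hKunr ψ hU hF hℓ hK u hu' fun hb => hnot (hsupp ?_)
    rwa [finBelow_finBelow P.F F K u] at hb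
  · -- `hKtame`
    exact hKtame ψ hU hF hℓ hK u fun h => hu (by rw [h]; simp)
  · -- `hFunr`: residue characteristic `∉ {2,3,5,ℓ}` ⊇-condition weakened to `∉ {2,3,5}`
    refine hFunr hU hF w (fun h => hw ?_) fun hb => hnot (hsupp hb)
    simp only [Finset.mem_insert, Finset.mem_singleton] at h ⊢
    rcases h with h | h | h <;> simp [h]
  · -- `hFtame`
    exact hFtame hU hF w hw

end Section64

/-! ## 4. The E5 junction on the theta tower: the descent spine needs NO §6.4 / §4.1 input -/

section Spine

variable {Lmod : Type*} [Field Lmod] [NumberField Lmod]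
variable {P : NFPoint} {F : Type} [Field F] [NumberField F] [Algebra P.F F]
variable {K : Type} [Field K] [NumberField K] [Algebra F K] (ψ : K →ₐ[F] AlgebraicClosure F)
variable {ℓ : ℕ} {hℓ : ℓ.Prime} {h5 : 5 ≤ ℓ}
variable {𝔮tpd : TateDivisorDatum P.F} {𝔮F : TateDivisorDatum F} {𝔮K : TateDivisorDatum K} {hq : 0 < 𝔮F.logq}
variable {d : LocusVolumeDatum} (G : MainBoundGlue (MainBoundDatum.ofGenuine Lmod hℓ h5 𝔮tpd 𝔮F 𝔮K hq) d)
include G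

/-- **E5 junction on the genuine theta tower**: E-t31's §6.8–§6.11 inputs (`Eq6111`, `Prop6109`, `ComponentSums`, `Eq6811`,
`Lem678`, the [J-III] lower bound `LowerBound` = Cor. 9.11.1.1 at `φ(y₀)`, `FrobShiftQ`, `FrobShiftVol`, `LogqDictionary`) + the glue
+ `ℓ ≥ 7` ⟹ the first inequality of Thm. 6.1.1 `(1/6)·log(𝔮_F) ≤ (1 + 20·d_mod/ℓ)·(log(d^{F_tpd}) + log(𝔣_{F_tpd})) +
20·(e*_mod·ℓ + 60)` — with E-t30's eight structural binders DISCHARGED (three support binders remain for general Tate data;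
none for `S = ∅`, cf. `section64_ofNFPoint`). Composition only; the located residuals stay E-t31's hypotheses BY NAME.
[claim: Joshi2024ATS4, status: disputed] -/
theorem thm611_left_of_descent (hU : P.InU) (hF : IsThetaField P F) [IsGalois F K] (h7 : 7 ≤ ℓ)
    (hK : letI := thetaCurve_isElliptic hU F
      ((thetaCurve P F).galoisRepTorsion (ℓ : ℤ)).ker ≤ ψ.fieldRange.fixingSubgroup)
    (hsupp : badPlaces P ⊆ 𝔮tpd.V)
    (hV : ∀ w : HeightOneSpectrum (𝓞 F), w ∈ 𝔮F.V ↔ finBelow P.F F w ∈ 𝔮tpd.V)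
    (hV' : ∀ u : HeightOneSpectrum (𝓞 K), u ∈ 𝔮K.V ↔ finBelow F K u ∈ 𝔮F.V)
    (h₁ : d.Eq6111) (h₂ : ∀ p ∈ d.Vdst, d.Prop6109 p) (h₃ : d.ComponentSums) (h₅ : d.Eq6811) (h₆ : d.Lem678)
    (h₇ : d.LowerBound) (h₈ : d.FrobShiftQ) (h₉ : d.FrobShiftVol) (hD : d.LogqDictionary) :
    1 / 6 * 𝔮F.logq ≤ (MainBoundDatum.ofGenuine Lmod hℓ h5 𝔮tpd 𝔮F 𝔮K hq).boundLtpd :=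
  haveI := hF.isGalois
  MainBoundDatum.ofGenuine_thm611_left_of_descent G h7 hV (hdvd hF) (hunr hU hF hsupp) (htame hU hF 𝔮tpd) hV'
    (hdvd' ψ hU hℓ hK) (hunr' ψ hU hF hℓ hK hsupp hV) (htame' ψ hU hF hℓ hK 𝔮F) h₁ h₂ h₃ h₅ h₆ h₇ h₈ h₉ hD

omit G in
/-- **E5 junction for Joshi's own data away from `S`** (`ofNFPoint P S`, `ofNFPointOver P S F/K`): support input = the avoidance
hypothesis `hS` only (Prop. 4.1.1 (2) on the `λ`-line at `S = {2,ℓ}`; vacuous at `S = ∅`). [claim: Joshi2024ATS4, status: disputed] -/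
theorem thm611_left_of_descent_ofNFPointOver [Algebra P.F K] [IsScalarTower P.F F K] (hU : P.InU) (hF : IsThetaField P F)
    [IsGalois F K] (h7 : 7 ≤ ℓ)
    (hK : letI := thetaCurve_isElliptic hU F
      ((thetaCurve P F).galoisRepTorsion (ℓ : ℤ)).ker ≤ ψ.fieldRange.fixingSubgroup)
    {S : Finset ℕ} (hS : ∀ v ∈ badPlaces P, ∀ p ∈ S, ((p : ℕ) : 𝓞 P.F) ∉ v.asIdeal)
    {hq : 0 < (TateDivisorDatum.ofNFPointOver P S F).logq}
    (G : MainBoundGlue (MainBoundDatum.ofGenuine Lmod hℓ h5 (TateDivisorDatum.ofNFPoint P S) (TateDivisorDatum.ofNFPointOver P S F) (TateDivisorDatum.ofNFPointOver P S K) hq) d)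
    (h₁ : d.Eq6111) (h₂ : ∀ p ∈ d.Vdst, d.Prop6109 p) (h₃ : d.ComponentSums) (h₅ : d.Eq6811) (h₆ : d.Lem678)
    (h₇ : d.LowerBound) (h₈ : d.FrobShiftQ) (h₉ : d.FrobShiftVol) (hD : d.LogqDictionary) :
    1 / 6 * (TateDivisorDatum.ofNFPointOver P S F).logq ≤
      (MainBoundDatum.ofGenuine Lmod hℓ h5 (TateDivisorDatum.ofNFPoint P S) (TateDivisorDatum.ofNFPointOver P S F) (TateDivisorDatum.ofNFPointOver P S K) hq).boundLtpd :=
  thm611_left_of_descent ψ G hU hF h7 hK (hsupp_ofNFPoint hS) (TateDivisorDatum.mem_ofNFPointOver_V_iff P S F)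
    (hV'_ofNFPointOver S) h₁ h₂ h₃ h₅ h₆ h₇ h₈ h₉ hD

end Spine

end Summit.ABC.IUTFork.Joshi.ATS4.ThetaTower

end
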